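import Literature.RepresentationTheory.Kovacevic2021.SU21Unitarity
import Literature.RepresentationTheory.Kovacevic2021.SU21KTypeMultiplicity
import HarnessLib

/-!
# Weighted Hermitian forms on Kovačević's `K`-type data: invariance from the matrix entries
# (the mechanism of Kovačević's Thm 4)

Continuation of `Literature.RepresentationTheory.Kovacevic2021.SU21Unitarity` (`IsUnitarizable`, the standard form,
the trivial module).  A diagonal **weighted** Hermitian form `⟨v, w⟩_c = Σ_t c_t conj(v_t) w_t` (`c_t > 0`) on
`𝒟.V` is `𝔰𝔲(2,1)`-invariant iff the weights satisfy Kovačević's sign conditions along the arrows: inside a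
`K`-type `c(n,m,k+1) = k(n-k) c(n,m,k)` (unitarity of `𝔨`), and across an `A`–`D` edge
`(n+1-k) A_{n,m} c(n+1,m+3,k) = -D_{n+1,m+3} c(n,m,k)` (so `A D' < 0`), across a `B`–`C` edge
`(k-1) C_{n,m} c(n-1,m+3,k-1) = -B_{n-1,m+3} c(n,m,k)` [Kovacevic2021, §4, proof of Thm 4: "the form is positive
iff `a d < 0`, `b c < 0`"].  §1–§2 set up the weighted form and reduce invariance to these ENTRY conditions on
basis vectors (`weightForm_comm_of_entries`); the sequel `SU21UnitarityRays` solves them on the north-east rays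
(`D₂ = U(0,6)`, `J_{1,0} = Z(3)`).

## References

* D. Kovačević, *Unitary `(𝔤,K)` modules of `SU(2,1)`*, Acta Math. Spalatensia 1 (2021) 105–125
  (arXiv:1810.01752): §4 Thm 4 and its proof. [Kovacevic2021]
* A. Borel, N. Wallach (2000), VI Thm 4.12 (2) p. 133. [BorelWallach2000]
-/

noncomputable section

open Finsupp

namespace Literature.RepresentationTheory.Kovacevic2021

-- Mathlib idiom (Mathlib/Algebra/Lie/OfAssociative.lean): commutator brackets on associative algebras; needed for
-- the `𝔤𝔩(3,ℂ)`-module structure on `𝒟.V`, as in every file of this directory.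
attribute [local instance 100] LieRing.ofAssociativeRing

namespace SU21Datum

variable (𝒟 : SU21Datum)

/-! ## §1 Weighted Hermitian forms -/

/-- **The weighted Hermitian form** `⟨v, w⟩_c = Σ_t c_t conj(v_t) w_t` in the basis `u^k_{n,m}`.
[cite: Kovacevic2021, §4 Thm 4] -/
def weightForm (c : 𝒟.Idx → ℝ) : 𝒟.V →ₗ⋆[ℂ] 𝒟.V →ₗ[ℂ] ℂ :=
  LinearMap.mk₂'ₛₗ (starRingEnd ℂ) (RingHom.id ℂ)
    (fun v w => v.sum fun t a => starRingEnd ℂ a * ((c t : ℂ) * w t))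
    (fun v₁ v₂ w => by
      rw [Finsupp.sum_add_index']
      · intro _; simp
      · intro _ a b; simp [add_mul])
    (fun a v w => by
      rw [Finsupp.sum_smul_index']
      · simp only [Finsupp.sum, smul_eq_mul, map_mul, Finset.mul_sum, mul_assoc]
      · intro _; simp)
    (fun v w₁ w₂ => by simp only [Finsupp.sum, Finsupp.add_apply, mul_add, Finset.sum_add_distrib])
    (fun a v w => by
      simp only [Finsupp.sum, Finsupp.smul_apply, smul_eq_mul, RingHom.id_apply, Finset.mul_sum, mul_left_comm])

variable (c : 𝒟.Idx → ℝ)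

/-- unfolding the weighted form [cite: Kovacevic2021, §4 Thm 4] -/
theorem weightForm_apply (v w : 𝒟.V) :
    𝒟.weightForm c v w = v.sum fun t a => starRingEnd ℂ a * ((c t : ℂ) * w t) := rfl

/-- the weighted form on a basis vector in the first slot [cite: Kovacevic2021, §4 Thm 4] -/
theorem weightForm_single_left (t : 𝒟.Idx) (a : ℂ) (w : 𝒟.V) :
    𝒟.weightForm c (single t a) w = starRingEnd ℂ a * ((c t : ℂ) * w t) := by
  rw [weightForm_apply, Finsupp.sum_single_index]
  rw [map_zero, zero_mul]

/-- the weighted form on a basis vector in the second slot [cite: Kovacevic2021, §4 Thm 4] -/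
theorem weightForm_single_right (v : 𝒟.V) (t : 𝒟.Idx) (b : ℂ) :
    𝒟.weightForm c v (single t b) = starRingEnd ℂ (v t) * ((c t : ℂ) * b) := by
  rw [weightForm_apply, Finsupp.sum]
  have : ∀ s ∈ v.support, starRingEnd ℂ (v s) * ((c s : ℂ) * single t b s)
      = if t = s then starRingEnd ℂ (v s) * ((c s : ℂ) * b) else 0 := by
    intro s _
    rw [Finsupp.single_apply]
    split_ifs <;> simp
  rw [Finset.sum_congr rfl this, Finset.sum_ite_eq]
  split_ifs with h
  · rfl
  · rw [Finsupp.notMem_support_iff.1 h, map_zero, zero_mul]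

/-- `⟨v, v⟩_c = Σ_t c_t |v_t|²` is real [cite: Kovacevic2021, §4 Thm 4] -/
theorem weightForm_self (v : 𝒟.V) : 𝒟.weightForm c v v = ((v.sum fun t a => c t * ‖a‖ ^ 2 : ℝ) : ℂ) := by
  rw [weightForm_apply, Finsupp.sum, Finsupp.sum, Complex.ofReal_sum]
  refine Finset.sum_congr rfl fun t _ => ?_
  rw [mul_left_comm, Complex.conj_mul', Complex.ofReal_mul, Complex.ofReal_pow]

/-- a weighted form with positive weights is positive definite [cite: Kovacevic2021, §4 Thm 4] -/
theorem weightForm_self_pos (hc : ∀ t, 0 < c t) {v : 𝒟.V} (hv : v ≠ 0) : 0 < (𝒟.weightForm c v v).re := by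
  rw [weightForm_self, Complex.ofReal_re, Finsupp.sum]
  obtain ⟨t, ht⟩ := Finsupp.support_nonempty_iff.2 hv
  exact Finset.sum_pos' (fun s _ => by have := hc s; positivity) ⟨t, ht, by
    have := Finsupp.mem_support_iff.1 ht; have := hc t; positivity⟩

/-- a weighted form (real weights) is Hermitian [cite: Kovacevic2021, §4 Thm 4] -/
theorem weightForm_conj_symm (v w : 𝒟.V) : 𝒟.weightForm c v w = starRingEnd ℂ (𝒟.weightForm c w v) := by
  rw [weightForm_apply, weightForm_apply, Finsupp.sum, Finsupp.sum, map_sum]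
  have h1 : (∑ t ∈ v.support, starRingEnd ℂ (v t) * ((c t : ℂ) * w t))
      = ∑ t ∈ v.support ∪ w.support, starRingEnd ℂ (v t) * ((c t : ℂ) * w t) :=
    Finset.sum_subset Finset.subset_union_left fun t _ ht => by
      rw [Finsupp.notMem_support_iff.1 ht, map_zero, zero_mul]
  have h2 : (∑ t ∈ w.support, starRingEnd ℂ (starRingEnd ℂ (w t) * ((c t : ℂ) * v t)))
      = ∑ t ∈ v.support ∪ w.support, starRingEnd ℂ (starRingEnd ℂ (w t) * ((c t : ℂ) * v t)) :=
    Finset.sum_subset Finset.subset_union_right fun t _ ht => by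
      rw [Finsupp.notMem_support_iff.1 ht, map_zero, zero_mul, map_zero]
  rw [h1, h2]
  refine Finset.sum_congr rfl fun t _ => ?_
  rw [map_mul, map_mul, Complex.conj_conj, Complex.conj_ofReal]
  ring

/-! ## §2 Invariance from the entries on basis vectors -/

/-- **Reduction to entries.** If the matrix entries of `X` and `Y` in the basis `u^k_{n,m}` satisfy
`conj(X_{ts}) c_t = ε c_s Y_{st}` for all labels, then `⟨X v, w⟩_c = ε ⟨v, Y w⟩_c` for all `v, w`.
[cite: Kovacevic2021, §4 proof of Thm 4] -/
theorem weightForm_comm_of_entries (X Y : Module.End ℂ 𝒟.V) (ε : ℂ)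
    (h : ∀ s t : 𝒟.Idx, starRingEnd ℂ (X (single s 1) t) * (c t : ℂ) = ε * ((c s : ℂ) * Y (single t 1) s))
    (v w : 𝒟.V) : 𝒟.weightForm c (X v) w = ε * 𝒟.weightForm c v (Y w) := by
  -- first for `v` a basis vector, by induction on `w`
  have key : ∀ (s : 𝒟.Idx) (w : 𝒟.V),
      𝒟.weightForm c (X (single s 1)) w = ε * 𝒟.weightForm c (single s 1) (Y w) := by
    intro s w
    induction w using Finsupp.induction_linear with
    | zero => simp only [map_zero, mul_zero]
    | add w₁ w₂ h₁ h₂ => rw [map_add, map_add, map_add, h₁, h₂, mul_add]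
    | single t b =>
      rw [weightForm_single_right, ← Finsupp.smul_single_one t b, map_smul, map_smul, smul_eq_mul,
        weightForm_single_left, map_one, one_mul]
      linear_combination b * h s t
  induction v using Finsupp.induction_linear with
  | zero => simp only [map_zero, LinearMap.zero_apply, mul_zero]
  | add v₁ v₂ h₁ h₂ =>
    rw [map_add, map_add, LinearMap.add_apply, map_add, LinearMap.add_apply, h₁, h₂, mul_add]
  | single s a =>
    rw [← Finsupp.smul_single_one s a, map_smul, LinearMap.map_smulₛₗ, LinearMap.smul_apply,
      LinearMap.map_smulₛₗ, LinearMap.smul_apply, key, smul_eq_mul, smul_eq_mul]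
    ring

end SU21Datum

end Literature.RepresentationTheory.Kovacevic2021
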